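import Summits.QuantumFields.YangMills.Theorems.FluctuationComparisonRegPrIntLS2BetaLaplaceLimit
import Literature.Analysis.Asymptotics.LaplaceMethodCompactGroupSmooth
import HarnessLib

/-!
# S2β · LAPLACE stub — letter LIMIT, the PEANO ROW: the door's three Hessian rows `hAs ∕ hpos ∕ hS2` from «`A ∘ σ` is `C²` at `0`» + GAP♯ along `σ`

Cell `ym3-torus` (rung R3: continuum `SU(2)` Yang–Mills on `T³` — NOT `d = 4`, NOT infinite volume, NOT a mass gap, NOT Clay); width seat `ym-ust-20520-w4` g15;
helper of the crux `stmt-QuantumFields-20520` (`--supports`, NOT a proof of it).  The seam's «GAP 2» (w5-20520 g13, 2026-08-29): the LIMIT door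
✓`…S2BetaLaplaceLimit.laplaceLimit_corner` carries three Hessian rows — a symmetric `Ah` (`hAs`), positive (`hpos`), with the Peano expansion `hS2` of
`φ := A ∘ σ` at `0` — that no supplier's letter states.  THIS FILE manufactures all three from QUALITATIVE data the suppliers own:
`ContDiffAt ℝ 2 φ 0` (CHART∞ ∕ (C3): the action through the smooth transversal) and the quadratic growth `φ y − φ 0 ≥ c‖y‖²` near `0`
(GAP♯ along `σ` with a transversality constant), using the tree's ✓`Literature.Analysis.Asymptotics.hasFDerivAt_data_of_contDiffAt_two` ∕
✓`isLittleO_taylor_two` (Riesz representative of the second derivative, symmetric by Schwarz), Mathlib `IsLocalMin.fderiv_eq_zero`, and ✓(L2 A)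
`inner_pos_of_quadratic_growth`.
* ★★`hessianRows_of_contDiffAt_of_growth` — `∃ Ah : Vt →ₗ[ℝ] Vt, Ah.IsSymmetric ∧ (∀ y ≠ 0, 0 < ⟪Ah y, y⟫) ∧ (φ y − φ 0 − ½⟪Ah y, y⟫ = o(‖y‖²))`.
HONEST SCOPE.  Calculus glue; nothing of CHART∞ ∕ GAP♯ ∕ LAPLACE ∕ S2β ∕ the crux 20520 is proved; `YM3TorusSU2` NOT proved; the Yang–Mills mass gap (Clay)
NOT proved.  Def-free; default heartbeats.
References: [Breitung1994] LNM 1592, Thm 41 p. 56 and Lemma 40 p. 55; [Balaban1985Variational] CMP 102 (1985) (142) p. 299.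
-/

noncomputable section

open Filter Topology Asymptotics
open scoped InnerProductSpace
open Literature.Analysis.Asymptotics
open Summit.QuantumFields.YangMills.Theorems.FluctuationComparisonRegPrIntLS2BetaLaplaceLimit

namespace Summit.QuantumFields.YangMills.Theorems.FluctuationComparisonRegPrIntLS2BetaLaplacePeano

variable {Vt : Type*} [NormedAddCommGroup Vt] [InnerProductSpace ℝ Vt] [CompleteSpace Vt]

/-- ★★ **THE DOOR'S HESSIAN ROWS FROM `C²` + QUADRATIC GROWTH.**  `φ : Vt → ℝ` `C²` at `0` with `φ y − φ 0 ≥ c‖y‖²` near `0` (`c > 0`).  Then there is a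
symmetric operator `Ah` (the Riesz representative of `D²φ(0)`) with `⟪Ah y, y⟫ > 0` for `y ≠ 0` and `φ y − φ 0 − ½⟪Ah y, y⟫ = o(‖y‖²)` — the rows
`hAs ∕ hpos ∕ hS2` of ✓`laplaceLimit_corner` (the linear term vanishes: `0` is a local minimum by the growth). [cite: Breitung1994, Thm 41 p. 56 and Lemma 40 p. 55]
[cite: Balaban1985Variational, (142) p. 299] -/
theorem hessianRows_of_contDiffAt_of_growth {φ : Vt → ℝ} (hφ : ContDiffAt ℝ 2 φ 0) {c : ℝ} (hc : 0 < c)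
    (hgrow : ∀ᶠ y in 𝓝 (0 : Vt), c * ‖y‖ ^ 2 ≤ φ y - φ 0) :
    ∃ Ah : Vt →ₗ[ℝ] Vt, Ah.IsSymmetric ∧ (∀ y, y ≠ 0 → 0 < ⟪Ah y, y⟫_ℝ) ∧
      (fun y => φ y - φ 0 - (1 / 2) * ⟪Ah y, y⟫_ℝ) =o[𝓝 0] fun y => ‖y‖ ^ 2 := by
  obtain ⟨hS1, hS2⟩ := hasFDerivAt_data_of_contDiffAt_two hφ
  set S'' : Vt →L[ℝ] Vt →L[ℝ] ℝ := fderiv ℝ (fderiv ℝ φ) 0 with hS''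
  set A : Vt →ₗ[ℝ] Vt :=
    ((InnerProductSpace.continuousLinearMapOfBilin (𝕜 := ℝ) S'' : Vt →L[ℝ] Vt) : Vt →ₗ[ℝ] Vt) with hAdef
  have hsymm : ∀ v w, S'' v w = S'' w v := second_derivative_symmetric_of_eventually_of_real hS1 hS2
  have hAS' : ∀ y z, ⟪A y, z⟫_ℝ = S'' y z := fun y z => by
    rw [hAdef, ContinuousLinearMap.coe_coe, InnerProductSpace.continuousLinearMapOfBilin_apply]
  have hA : A.IsSymmetric := fun y z => by
    rw [hAS', hsymm, ← hAS', real_inner_comm]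
  -- `0` is a local minimum, so the linear term vanishes
  have hmin : IsLocalMin φ 0 := by
    filter_upwards [hgrow] with y hy
    nlinarith [sq_nonneg ‖y‖, hc.le]
  have hcrit : fderiv ℝ φ 0 = 0 := hmin.fderiv_eq_zero
  have hPeano : (fun y => φ y - φ 0 - (1 / 2) * ⟪A y, y⟫_ℝ) =o[𝓝 0] fun y => ‖y‖ ^ 2 := by
    have h := isLittleO_taylor_two hS1 hS2
    refine (h.congr' (Eventually.of_forall fun x => ?_) (Eventually.of_forall fun x => ?_))
    · simp only [hcrit, zero_apply, sub_zero, hAS']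
    · simp only [sub_zero]
  exact ⟨A, hA, inner_pos_of_quadratic_growth hc hgrow hPeano, hPeano⟩

end Summit.QuantumFields.YangMills.Theorems.FluctuationComparisonRegPrIntLS2BetaLaplacePeano

end
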